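import Summits.ABC.IUTFork.Joshi.DictionaryHarnessBridge
import HarnessLib

/-!
# Branch E, X-07′ pins report: the label-0 artefact of the typed Θ-pin (adversary seat abc-iut-E-cx)

AUTHORED BY abc-iut-E-cx (refuter seat refuter-abc-iut-E-cx-g0-0); proxy-filed VERBATIM by a prover hand per the cell's PROXY RULE
(plan/repair/REPAIR-SPEC.md §2). Record file of the abc-iut cell, branch E «type Joshi's construction, test vs S» (rung LADDER-ABC:A2.E;
X-07′ sign-off criterion (iv) «pins report», abc-iut-E-cx 06:50:46Z / 08:00:11Z). **No side is taken** on [IUTchIII] Cor. 3.12, on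
Joshi's claims (unrefereed arXiv preprints) or on Mochizuki's report on them; typed ≠ proved ≠ endorsed. PROOF-ONLY, 0 new `def`,
no `Prop` fact, no instance, no `sorry`.

## Content (generic over the lattice binders `(S, P, ρ)` of S)
The equivariance half (hρ) of abc-iut-w5-d230's `Cor312Vol.ThetaPinned S P ρ` quantifies over EVERY packet label `j ∈ |𝔽_l|`,
label `0` included, while the Kummer data `Ψ ⊆ ∏_{j ∈ 𝔽_l^⋇} 𝓘^ℚ(…)` live in `LogShells.StarPacket v := ∀ j : T.LabelStar, …`
(Thm311Multirad l. 72), on which a packet-automorphism family acts through its components at the labels `j ≥ 1` only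
(`LogShells.starAut`, l. 82). Hence (`image_rho_eq_of_thetaPinned`): under `ThetaPinned`, every element of `⟨(Ind1) ∪ (Ind2)⟩` acting
trivially on the star packets — e.g. one supported at label `0` (`starAut_eq_refl_of_labelStar`) — STABILISES `ρ Ψ j v_ℚ` for every
datum `Ψ` and every label; in particular (`image_rho_zero_eq_of_thetaPinned`) the label-`0` components of (Ind2) = `Ism`-built families
stabilise the label-`0` region `ρ Ψ 0 v_ℚ`. For a ball-valued `ρ₀` (the pinned model's `orbitRegion`: `B_0`; forced to be a hull-set by
`Setting.qRegion_mem` + `QPinned`) this says: **the typed Θ-pin already makes `Ism` act isometrically at label 0** — satisfied by the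
model of record (`Ism = {±1}`) and by the Dupuy–Hilado-level isometries, violated by any "Ism" containing a valuation-rescaling scalar
(the Joshi-style `ism := univ` of X-07′, abc-iut-E-t41's `TestIsmScaling`, whose pins report therefore reads «(hρ) fails as typed at
label 0 only»). A LOCATED artefact of OUR signature (label 0 does not enter the Statement of Cor. 3.12, which averages over `j ∈ 𝔽_l^⋇`);
no judgement on print. [claim: Mochizuki2012, status: disputed]. Standard axioms only; no `sorry`.
-/

noncomputable section

open Set

namespace Summit.ABC.IUTFork.Joshi

open Thm311 Cor312 Cor312Vol

variable {T : ThetaIndex} {S : LatticeSituation T} {P : Cor312.Setting S.toSituation}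
  {ρ : (∀ v : T.V, v ∈ T.Vbad → Set (S.L.StarPacket v)) → ∀ (j : T.Label) (vQ : T.VQ), Set (S.L.Packet j vQ)}

/-- **(hρ) ⟹ star-trivial indeterminacies stabilise every `ρ`-region.** If `Φ ∈ ⟨(Ind1) ∪ (Ind2)⟩` acts as the identity on every star
packet `∏_{j ∈ 𝔽_l^⋇} 𝓘^ℚ(^{S^±_{j+1},j};𝒟⊢_v)`, then under `ThetaPinned` it fixes `ρ Ψ j v_ℚ` (as a set) for every datum `Ψ` and
every label `j`. [folklore] -/
theorem image_rho_eq_of_thetaPinned (hΘ : ThetaPinned S P ρ) {Φ : S.L.PacketAut}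
    (hΦ : Φ ∈ Subgroup.closure (S.L.Ind1Family ∪ S.L.Ind2Family))
    (h0 : ∀ v : T.V, S.L.starAut Φ v = LinearEquiv.refl ℚ _)
    (Ψ : ∀ v : T.V, v ∈ T.Vbad → Set (S.L.StarPacket v)) (j : T.Label) (vQ : T.VQ) :
    Φ j vQ '' ρ Ψ j vQ = ρ Ψ j vQ := by
  have h := hΘ.1 Φ hΦ Ψ j vQ
  have hΨ : (fun v hv => S.L.starAut Φ v '' Ψ v hv) = Ψ := by
    funext v hv; rw [h0 v]; exact Set.image_id _
  rw [hΨ] at h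
  exact h.symm

/-- **Families supported at label `0` are star-trivial**: if `Φ` is the identity at every label `j ∈ 𝔽_l^⋇` (whatever it does at
label `0`), it acts as the identity on the star packets. [folklore] -/
theorem starAut_eq_refl_of_labelStar {Φ : S.L.PacketAut}
    (h : ∀ (j : T.LabelStar) (vQ : T.VQ), Φ j.1 vQ = LinearEquiv.refl ℚ _) (v : T.V) :
    S.L.starAut Φ v = LinearEquiv.refl ℚ _ := by
  refine LinearEquiv.ext fun x => funext fun j => ?_
  show Φ j.1 (T.over v) (x j) = x j
  rw [h j]; rfl

/-- **The label-0 artefact of the typed Θ-pin.** Under `ThetaPinned`, an element of `⟨(Ind1) ∪ (Ind2)⟩` that is the identity at the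
labels `j ≥ 1` stabilises the label-`0` region `ρ Ψ 0 v_ℚ` of EVERY datum: for ball-valued `ρ₀` the Θ-pin forces the label-`0`
components of (Ind2) — built from `Ism` exactly like the other labels — to act isometrically there. (Pins REPORT item for X-07′:
with `ism := univ` the family «`p` at label 0, `1` elsewhere» lies in (Ind2) and moves `B_0`, so (hρ) fails as typed at label 0.)
[claim: Mochizuki2012, status: disputed] -/
theorem image_rho_zero_eq_of_thetaPinned (hΘ : ThetaPinned S P ρ) {Φ : S.L.PacketAut}
    (hΦ : Φ ∈ Subgroup.closure (S.L.Ind1Family ∪ S.L.Ind2Family))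
    (h : ∀ (j : T.LabelStar) (vQ : T.VQ), Φ j.1 vQ = LinearEquiv.refl ℚ _)
    (Ψ : ∀ v : T.V, v ∈ T.Vbad → Set (S.L.StarPacket v)) (vQ : T.VQ) :
    Φ 0 vQ '' ρ Ψ 0 vQ = ρ Ψ 0 vQ :=
  image_rho_eq_of_thetaPinned hΘ hΦ (starAut_eq_refl_of_labelStar h) Ψ 0 vQ

/-- **Contrapositive, the form a pins report uses**: a generator supported at label `0` that MOVES some label-`0` region `ρ Ψ 0 v_ℚ`
refutes `ThetaPinned` (hence `PinnedRegions`, `PinnedRegions3`) for that `ρ`. [claim: Mochizuki2012, status: disputed] -/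
theorem not_thetaPinned_of_moves_zero {Φ : S.L.PacketAut} (hΦ : Φ ∈ S.L.Ind1Family ∪ S.L.Ind2Family)
    (h : ∀ (j : T.LabelStar) (vQ : T.VQ), Φ j.1 vQ = LinearEquiv.refl ℚ _)
    {Ψ : ∀ v : T.V, v ∈ T.Vbad → Set (S.L.StarPacket v)} {vQ : T.VQ} (hmove : Φ 0 vQ '' ρ Ψ 0 vQ ≠ ρ Ψ 0 vQ) :
    ¬ ThetaPinned S P ρ ∧ ∀ qK, ¬ PinnedRegions S P ρ qK := by
  have hn : ¬ ThetaPinned S P ρ := fun hΘ =>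
    hmove (image_rho_zero_eq_of_thetaPinned hΘ (Subgroup.subset_closure hΦ) h Ψ vQ)
  exact ⟨hn, fun _ hpin => hn hpin.1⟩

end Summit.ABC.IUTFork.Joshi

end
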